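import Mathlib

/-!
# T6N3AdmSpan — the generating sentence for products through a lift (Mathlib-only helper)

Cell pub-hodge-repro2, Tier 6 (README §10), seat t6-p3 (N3 owner, M2). Proof lane; carrier-free,
Mathlib only. The sentence N2 and N3 share (`N2Datum.AdmGenerating`, T6N3Main2: «every single product
of vertex forms is a linear combination of single products of ADMISSIBLE data») is, on the host,
a statement about the VERTEX FORMS: the product `F(φ_a, φ_b) = η_a(φ_a) · η_b(φ_b)` factors through the
lifts `η_a`, `η_b` of the Schwartz data (TIER5 N3.2(d)), and B7(b)'s admissible data are exactly the
Schwartz data whose vertex forms are the ℚ-rational ones of Liu Thm. 4.18(1) — which SPAN the vertex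
forms of every level. This file is the linear algebra of that reading: if a bilinear `G` is composed
with linear lifts `η_a`, `η_b`, and the lifts of the admissible sets span the lifts of all data, then
the products of admissible data span the products of all data (`span_image2_comp_eq_of_span_image`).
With `F := G.compl₁₂ η_a η_b` this IS `productModuleOn X admA admB = productModule X`, i.e.
`AdmGenerating` — without asking the admissible Schwartz data themselves to span anything.

§8(d): uses an L-value-free non-vanishing device: NO.
-/

namespace Summit.Ventures.HodgeRepro2.T6.AdmSpan

variable {R : Type*} [CommRing R]
variable {Sa Sb Va Vb W : Type*} [AddCommGroup Sa] [Module R Sa] [AddCommGroup Sb] [Module R Sb]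
  [AddCommGroup Va] [Module R Va] [AddCommGroup Vb] [Module R Vb] [AddCommGroup W] [Module R W]

/-- A product `G x y` of two vectors in the spans of `T_a ⊆ V_a`, `T_b ⊆ V_b` lies in the span of the
products `G t_a t_b`, `t_a ∈ T_a`, `t_b ∈ T_b` (bilinearity). -/
theorem apply_mem_span_image2_of_mem_span (G : Va →ₗ[R] Vb →ₗ[R] W) {TA : Set Va} {TB : Set Vb}
    {x : Va} (hx : x ∈ Submodule.span R TA) {y : Vb} (hy : y ∈ Submodule.span R TB) :
    G x y ∈ Submodule.span R (Set.image2 (fun a b => G a b) TA TB) := by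
  refine Submodule.span_induction
    (p := fun x _ => G x y ∈ Submodule.span R (Set.image2 (fun a b => G a b) TA TB)) ?_ ?_ ?_ ?_ hx
  · intro a ha
    refine Submodule.span_induction
      (p := fun y _ => G a y ∈ Submodule.span R (Set.image2 (fun a b => G a b) TA TB)) ?_ ?_ ?_ ?_ hy
    · intro b hb
      exact Submodule.subset_span (Set.mem_image2_of_mem ha hb)
    · rw [map_zero]
      exact Submodule.zero_mem _
    · intro b b' _ _ h h'
      rw [map_add]
      exact Submodule.add_mem _ h h'
    · intro c b _ h
      rw [map_smul]
      exact Submodule.smul_mem _ c h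
  · rw [map_zero, LinearMap.zero_apply]
    exact Submodule.zero_mem _
  · intro a a' _ _ h h'
    rw [map_add, LinearMap.add_apply]
    exact Submodule.add_mem _ h h'
  · intro c a _ h
    rw [map_smul, LinearMap.smul_apply]
    exact Submodule.smul_mem _ c h

/-- THE GENERATING SENTENCE THROUGH A LIFT: for the products `G (η_a φ_a) (η_b φ_b)` of lifted data, if
the lifts of the admissible sets `S_a`, `S_b` span the lifts of ALL data, then the admissible products
span the same submodule as all products. -/
theorem span_image2_comp_eq_of_span_image (G : Va →ₗ[R] Vb →ₗ[R] W) (ηa : Sa →ₗ[R] Va)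
    (ηb : Sb →ₗ[R] Vb) (SA : Set Sa) (SB : Set Sb)
    (hA : ∀ φa : Sa, ηa φa ∈ Submodule.span R (ηa '' SA))
    (hB : ∀ φb : Sb, ηb φb ∈ Submodule.span R (ηb '' SB)) :
    Submodule.span R (Set.image2 (fun φa φb => G (ηa φa) (ηb φb)) SA SB) =
      Submodule.span R (Set.range fun p : Sa × Sb => G (ηa p.1) (ηb p.2)) := by
  refine le_antisymm (Submodule.span_mono ?_) (Submodule.span_le.mpr ?_)
  · rintro _ ⟨φa, _, φb, _, rfl⟩
    exact ⟨(φa, φb), rfl⟩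
  · rintro _ ⟨⟨φa, φb⟩, rfl⟩
    have key := apply_mem_span_image2_of_mem_span G (hA φa) (hB φb)
    refine Submodule.span_mono ?_ key
    rintro _ ⟨_, ⟨a, ha, rfl⟩, _, ⟨b, hb, rfl⟩, rfl⟩
    exact Set.mem_image2_of_mem ha hb

/-- The same, with the products written through the composed bilinear map `G.compl₁₂ η_a η_b` (the
shape of the N3 datum's `F`). -/
theorem span_image2_compl₁₂_eq_of_span_image (G : Va →ₗ[R] Vb →ₗ[R] W) (ηa : Sa →ₗ[R] Va)
    (ηb : Sb →ₗ[R] Vb) (SA : Set Sa) (SB : Set Sb)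
    (hA : ∀ φa : Sa, ηa φa ∈ Submodule.span R (ηa '' SA))
    (hB : ∀ φb : Sb, ηb φb ∈ Submodule.span R (ηb '' SB)) :
    Submodule.span R (Set.image2 (fun φa φb => G.compl₁₂ ηa ηb φa φb) SA SB) =
      Submodule.span R (Set.range fun p : Sa × Sb => G.compl₁₂ ηa ηb p.1 p.2) :=
  span_image2_comp_eq_of_span_image G ηa ηb SA SB hA hB

end Summit.Ventures.HodgeRepro2.T6.AdmSpan
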